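import Summits.QuantumFields.YangMills.Theorems.BalabanUVNodesK0V23Stub3DoorSuppliers
import Summits.QuantumFields.YangMills.Theorems.BalabanUVNodesK2R9Holds

/-!
# NODE N24 (B2) — THE K0⁷–K1⁹ JUNCTION AT THE COFINAL β-SOCKET, BY NAME: ONE NODE-O deliverable (the K1 face ✓p782330's last binder `hβc`) is k0's door (α_cof) `K0BoxCofinalRadii` PLUS K1⁹'s rows,
# hence inhabits K0⁷ `Record13SepCoPHInhabited` BY NAME (k0 DEF-1 ✓p781725's closer); and the rung R4 `BalabanLadder.UV` then needs, beyond the cofinal K1 face's children, only K3⁸ — K2⁹ being PROVED (`K2R9Holds`)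

TRACK A (YM-PLAN §2d, node N24 of 28 = binder B2, COMPOSITE), seat `pub-ymgap-dag-n24-c` (R134 s2; gen 21, INTENT-6).  Key of record K1⁹ = stmt-QuantumFields-27364 (`--kind proof --supports 27364 --as helper`;
Summits lane; count-neutral).  [I] = [Balaban1987RG1]; [V] = [Balaban1989LargeFieldII]; [B11] = [Balaban1985Variational].

WHY (P3 g84 spec `ENGINE-v2-cofinal-socket.md` §3; director-ym №399 (2) «a line ENDS in K0⁷'s decl BY NAME through the weakest radius door it reaches», №402 (R), №406 (2)).  The cofinal K1 engine
✓p782234 ∕ face ✓p782330 display K0⁷ ⊕ NODE O as ONE binder `hβc : ∀ F, ∀ a > 0, ∃ a₀, 0 < a₀ ≤ a ∧ ∃ (γ₀ ε₂₉ β′) (j ε₀ B₃ B₃′ a₁ Efl logz), 0 < γ₀ ∧ 0 < ε₂₉ ∧ ⟨abs box of β₁₃ at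
θ₁₃ᶜᶜᴹᵂᶻᴮ(j; ½; a₀; ε₀, ε₂₉; B₃, B₃′, a₀, a₁; Efl, logz) on ]0, γ₀]⟩ ∧ ∃ (b r γ₁ M), 0 < γ₁ ∧ ⟨NODE O's rows (i) (iv) (C) at that β, level γ₁⟩`.  Its box part IS the body of k0's door
`K0V23Stub3DoorSuppliers.K0BoxCofinalRadii` at `F`, conjunct for conjunct; so (§1) `hβc` PROJECTS to (α_cof) (drop the rows) and (§2) K0⁷'s route decl `Record13SepCoPHInhabited` follows BY NAME from
the SAME binder by k0's `record13SepCoPHInhabited_of_k0BoxCofinalRadii` — the K0–K1 junction is consistent on the radius axis: ONE producer of `hβc` serves BOTH cruxes (K1⁹ through the face with its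
children).  §3 reads the route's `closes` at that junction: with `h0 := §2 hβc` and K2⁹ PROVED (`BalabanUVNodesK2R9Holds.endpointGivenRunRowsR13SepCoPHV_holds`), the rung R4 `BalabanLadder.UV`
follows from `hβc`, K1⁹ (= the cofinal face's conclusion from `hβc` + its displayed children) and K3⁸ `SpineGivenEndpointR13SepCoPHV` (stmt-QuantumFields-27366) — by name, nothing else.

WHAT (3 theorems, 0 `def`, 0 `sorry`; standard axioms): §1 `k0BoxCofinalRadii_of_cofinalBetaSocket` · §2 ★ `record13SepCoPHInhabited_of_cofinalBetaSocket` · §3 ★ `uv_of_cofinalBetaSocket_of_k1_of_k3`.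

HONEST FRAMING.  Composition BY NAME (a projection + k0's closer + the route's `closes`); NO estimate; nothing of Bałaban's asserted; `hβc` is NOBODY's theorem (NODE O's wall in the (α_cof)
currency — director №398∕№399 doors); K0⁷ ∕ K1⁹ ∕ K3⁸ NOT closed (displayed as hypotheses ∕ derived conditionally), K2⁹ is k2's theorem; NOT a closure of any item; N24 COMPOSITE — no count moved
(COUNT 8∕27 · K 1∕4); one finite 𝕋⁴ programme at fixed ε, Bałaban AS PRINTED; R4 = the conditional finite-𝕋⁴ rung `BalabanLadder.UV` only — NOT continuum ∕ ℝ⁴ ∕ OS ∕ mass gap ∕ Clay: the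
Yang–Mills mass gap is NOT proved by any of this.  No `sorry`, `def`, `instance`, `notation`.
-/

noncomputable section

open scoped BigOperators

namespace Summit.QuantumFields.YangMills.BalabanUVNodes.N24K0K1JunctionOfCofinalBetaSocket

open Literature.MathematicalPhysics.QuantumFieldTheory.Balaban1983to89
open Literature.MathematicalPhysics.QuantumFieldTheory.Balaban1983to89.FlowStep
open Literature.MathematicalPhysics.QuantumFieldTheory.Balaban1983to89.Node00
open Literature.MathematicalPhysics.QuantumFieldTheory.Balaban1983to89.T4Continuum (T4Family)
open Summit.QuantumFields.YangMills.Theorems.K0V23Stub3DoorSuppliers (K0BoxCofinalRadii record13SepCoPHInhabited_of_k0BoxCofinalRadii)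
open Summit.QuantumFields.YangMills.Theorems.BalabanUVNodesK2R9Holds (endpointGivenRunRowsR13SepCoPHV_holds)
open Summit.QuantumFields.YangMills.Theses.BalabanUVNodes (Record13SepCoPHInhabited StabilityBRunRowsAtRecordR13SepCoPHV SpineGivenEndpointR13SepCoPHV closes)

/-! ## §1. The cofinal β-socket PROJECTS to k0's door (α_cof) (drop NODE O's rows) -/

/-- **THE COFINAL β-SOCKET ⟹ DOOR (α_cof)**: dropping the rows conjunct of the K1 face's binder `hβc` (✓p782330 ∕ engine ✓p782234, P3 (R1)) gives k0's `K0BoxCofinalRadii` — the box part of the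
socket IS that door's body at `F`, conjunct for conjunct (bookkeeping: one `obtain`). [cite: Balaban1987RG1, Thm 1 p.259, Thm 3 p.264, (1.20)–(1.22) p.264 (bookkeeping)] -/
theorem k0BoxCofinalRadii_of_cofinalBetaSocket
    (hβc : ∀ F : T4Family, ∀ a : ℝ, 0 < a → ∃ a₀ : ℝ, 0 < a₀ ∧ a₀ ≤ a ∧
      ∃ (γ₀ ε₂₉ β' : ℝ) (j : ℕ) (ε₀ B₃ B₃' a₁ : ℝ) (Efl logz : B12.RunParams → ℕ → ℝ), 0 < γ₀ ∧ 0 < ε₂₉ ∧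
        BetaLowerH (-β') γ₀ (betaOfRecord₁₃ F 2 (theta13OfThm1CCMWZB F 2 j (1 / 2) a₀ ε₀ ε₂₉ B₃ B₃' a₀ a₁ Efl logz)) ∧
        BetaUpperH β' γ₀ (betaOfRecord₁₃ F 2 (theta13OfThm1CCMWZB F 2 j (1 / 2) a₀ ε₀ ε₂₉ B₃ B₃' a₀ a₁ Efl logz)) ∧
        ∃ (b : ℕ → ℝ) (r γ₁ M : ℝ), 0 < γ₁ ∧
          (∀ (n : ℕ) (gs : ℕ → ℝ), RGEqH n (betaOfRecord₁₃ F 2 (theta13OfThm1CCMWZB F 2 j (1 / 2) a₀ ε₀ ε₂₉ B₃ B₃' a₀ a₁ Efl logz)) gs → Step.InInterval γ₁ n gs → ∀ k, k ≤ n → |betaOfRecord₁₃ F 2 (theta13OfThm1CCMWZB F 2 j (1 / 2) a₀ ε₀ ε₂₉ B₃ B₃' a₀ a₁ Efl logz) k (prefixOf gs k) - b k| ≤ r) ∧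
          (∀ (n : ℕ) (gs : ℕ → ℝ), RGEqH n (betaOfRecord₁₃ F 2 (theta13OfThm1CCMWZB F 2 j (1 / 2) a₀ ε₀ ε₂₉ B₃ B₃' a₀ a₁ Efl logz)) gs → Step.InInterval γ₁ n gs → ∀ k, k ≤ n → -M ≤ ∑ i ∈ Finset.Ico k n, betaOfRecord₁₃ F 2 (theta13OfThm1CCMWZB F 2 j (1 / 2) a₀ ε₀ ε₂₉ B₃ B₃' a₀ a₁ Efl logz) i (prefixOf gs i)) ∧
          ∀ k : ℕ, ContinuousOn (fun x : ℝ => betaOfRecord₁₃ F 2 (theta13OfThm1CCMWZB F 2 j (1 / 2) a₀ ε₀ ε₂₉ B₃ B₃' a₀ a₁ Efl logz) k (clampPrefix (betaOfRecord₁₃ F 2 (theta13OfThm1CCMWZB F 2 j (1 / 2) a₀ ε₀ ε₂₉ B₃ B₃' a₀ a₁ Efl logz)) γ₁ k x))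
            {x : ℝ | 0 < x ∧ x ≤ γ₁ ∧ ∀ i, i ≤ k → 1 / γ₁ ^ 2 ≤ Y (betaOfRecord₁₃ F 2 (theta13OfThm1CCMWZB F 2 j (1 / 2) a₀ ε₀ ε₂₉ B₃ B₃' a₀ a₁ Efl logz)) γ₁ i x}) :
    K0BoxCofinalRadii := by
  intro F a ha
  obtain ⟨a₀, ha₀, hle, γ₀, ε₂₉, β', j, ε₀, B₃, B₃', a₁, Efl, logz, hγ₀, hε, hlow, hup, -⟩ := hβc F a ha
  exact ⟨a₀, ha₀, hle, γ₀, ε₂₉, β', j, ε₀, B₃, B₃', a₁, Efl, logz, hγ₀, hε, hlow, hup⟩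

/-! ## §2. ★ K0⁷'s route decl BY NAME from the cofinal β-socket (k0's closer `record13SepCoPHInhabited_of_k0BoxCofinalRadii`) -/

/-- **★ THE K0–K1 JUNCTION ON THE RADIUS AXIS**: the K1 face's cofinal β-socket `hβc` inhabits K0⁷ `Theses.BalabanUVNodes.Record13SepCoPHInhabited` BY NAME (§1 ∘ k0 DEF-1's
`record13SepCoPHInhabited_of_k0BoxCofinalRadii` ✓p781725: stub 1ᴮ's token shrunk to the producer's radius by `Prop8RegSepTopStepGB.of_le`, 2′ printed, the ᴮ seam `rfl`).  So ONE NODE-O producer of `hβc`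
serves K0⁷ directly AND K1⁹ through the cofinal face ✓p782330 (with its displayed children).  CONDITIONAL on `hβc` (nobody's theorem); K0⁷ NOT closed. [cite: Balaban1985Variational, Thm 1 (8)–(9) p.279, Prop. 8 p.304; Balaban1985RegularSpaces, Prop. 6 p.99; Balaban1988Convergent, Thm 1 p.262, (2.12)–(2.13) pp.256–257; Balaban1987RG1, Thm 1 p.259, Thm 3 p.264, (1.20)–(1.22) p.264 (bookkeeping)] -/
theorem record13SepCoPHInhabited_of_cofinalBetaSocket
    (hβc : ∀ F : T4Family, ∀ a : ℝ, 0 < a → ∃ a₀ : ℝ, 0 < a₀ ∧ a₀ ≤ a ∧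
      ∃ (γ₀ ε₂₉ β' : ℝ) (j : ℕ) (ε₀ B₃ B₃' a₁ : ℝ) (Efl logz : B12.RunParams → ℕ → ℝ), 0 < γ₀ ∧ 0 < ε₂₉ ∧
        BetaLowerH (-β') γ₀ (betaOfRecord₁₃ F 2 (theta13OfThm1CCMWZB F 2 j (1 / 2) a₀ ε₀ ε₂₉ B₃ B₃' a₀ a₁ Efl logz)) ∧
        BetaUpperH β' γ₀ (betaOfRecord₁₃ F 2 (theta13OfThm1CCMWZB F 2 j (1 / 2) a₀ ε₀ ε₂₉ B₃ B₃' a₀ a₁ Efl logz)) ∧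
        ∃ (b : ℕ → ℝ) (r γ₁ M : ℝ), 0 < γ₁ ∧
          (∀ (n : ℕ) (gs : ℕ → ℝ), RGEqH n (betaOfRecord₁₃ F 2 (theta13OfThm1CCMWZB F 2 j (1 / 2) a₀ ε₀ ε₂₉ B₃ B₃' a₀ a₁ Efl logz)) gs → Step.InInterval γ₁ n gs → ∀ k, k ≤ n → |betaOfRecord₁₃ F 2 (theta13OfThm1CCMWZB F 2 j (1 / 2) a₀ ε₀ ε₂₉ B₃ B₃' a₀ a₁ Efl logz) k (prefixOf gs k) - b k| ≤ r) ∧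
          (∀ (n : ℕ) (gs : ℕ → ℝ), RGEqH n (betaOfRecord₁₃ F 2 (theta13OfThm1CCMWZB F 2 j (1 / 2) a₀ ε₀ ε₂₉ B₃ B₃' a₀ a₁ Efl logz)) gs → Step.InInterval γ₁ n gs → ∀ k, k ≤ n → -M ≤ ∑ i ∈ Finset.Ico k n, betaOfRecord₁₃ F 2 (theta13OfThm1CCMWZB F 2 j (1 / 2) a₀ ε₀ ε₂₉ B₃ B₃' a₀ a₁ Efl logz) i (prefixOf gs i)) ∧
          ∀ k : ℕ, ContinuousOn (fun x : ℝ => betaOfRecord₁₃ F 2 (theta13OfThm1CCMWZB F 2 j (1 / 2) a₀ ε₀ ε₂₉ B₃ B₃' a₀ a₁ Efl logz) k (clampPrefix (betaOfRecord₁₃ F 2 (theta13OfThm1CCMWZB F 2 j (1 / 2) a₀ ε₀ ε₂₉ B₃ B₃' a₀ a₁ Efl logz)) γ₁ k x))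
            {x : ℝ | 0 < x ∧ x ≤ γ₁ ∧ ∀ i, i ≤ k → 1 / γ₁ ^ 2 ≤ Y (betaOfRecord₁₃ F 2 (theta13OfThm1CCMWZB F 2 j (1 / 2) a₀ ε₀ ε₂₉ B₃ B₃' a₀ a₁ Efl logz)) γ₁ i x}) :
    Record13SepCoPHInhabited :=
  record13SepCoPHInhabited_of_k0BoxCofinalRadii (k0BoxCofinalRadii_of_cofinalBetaSocket hβc)

/-! ## §3. ★ The rung R4 read at this junction: `BalabanLadder.UV` from `hβc`, K1⁹ and K3⁸ BY NAME (K2⁹ PROVED) -/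

/-- **★ THE RUNG AT THE JUNCTION**: the route's deciding theorem `Theses.BalabanUVNodes.closes` with `h0 :=` §2 (K0⁷ from the cofinal β-socket) and `h2 :=` k2's PROVED K2⁹
(`BalabanUVNodesK2R9Holds.endpointGivenRunRowsR13SepCoPHV_holds`): the rung R4 `Theses.BalabanLadder.UV` follows from `hβc`, K1⁹ `StabilityBRunRowsAtRecordR13SepCoPHV` (itself = the cofinal K1
face ✓p782330's conclusion from `hβc` and its displayed N05–N13 children) and K3⁸ `SpineGivenEndpointR13SepCoPHV` (stmt-QuantumFields-27366) — by name, nothing else.  CONDITIONAL (audit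
`proof.conditional`); R4 NOT proved; no count moved. [cite: Balaban1989LargeFieldII, Thm 1 p.355; Balaban1987RG1, Thm 3 p.264 (bookkeeping)] -/
theorem uv_of_cofinalBetaSocket_of_k1_of_k3
    (hβc : ∀ F : T4Family, ∀ a : ℝ, 0 < a → ∃ a₀ : ℝ, 0 < a₀ ∧ a₀ ≤ a ∧
      ∃ (γ₀ ε₂₉ β' : ℝ) (j : ℕ) (ε₀ B₃ B₃' a₁ : ℝ) (Efl logz : B12.RunParams → ℕ → ℝ), 0 < γ₀ ∧ 0 < ε₂₉ ∧
        BetaLowerH (-β') γ₀ (betaOfRecord₁₃ F 2 (theta13OfThm1CCMWZB F 2 j (1 / 2) a₀ ε₀ ε₂₉ B₃ B₃' a₀ a₁ Efl logz)) ∧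
        BetaUpperH β' γ₀ (betaOfRecord₁₃ F 2 (theta13OfThm1CCMWZB F 2 j (1 / 2) a₀ ε₀ ε₂₉ B₃ B₃' a₀ a₁ Efl logz)) ∧
        ∃ (b : ℕ → ℝ) (r γ₁ M : ℝ), 0 < γ₁ ∧
          (∀ (n : ℕ) (gs : ℕ → ℝ), RGEqH n (betaOfRecord₁₃ F 2 (theta13OfThm1CCMWZB F 2 j (1 / 2) a₀ ε₀ ε₂₉ B₃ B₃' a₀ a₁ Efl logz)) gs → Step.InInterval γ₁ n gs → ∀ k, k ≤ n → |betaOfRecord₁₃ F 2 (theta13OfThm1CCMWZB F 2 j (1 / 2) a₀ ε₀ ε₂₉ B₃ B₃' a₀ a₁ Efl logz) k (prefixOf gs k) - b k| ≤ r) ∧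
          (∀ (n : ℕ) (gs : ℕ → ℝ), RGEqH n (betaOfRecord₁₃ F 2 (theta13OfThm1CCMWZB F 2 j (1 / 2) a₀ ε₀ ε₂₉ B₃ B₃' a₀ a₁ Efl logz)) gs → Step.InInterval γ₁ n gs → ∀ k, k ≤ n → -M ≤ ∑ i ∈ Finset.Ico k n, betaOfRecord₁₃ F 2 (theta13OfThm1CCMWZB F 2 j (1 / 2) a₀ ε₀ ε₂₉ B₃ B₃' a₀ a₁ Efl logz) i (prefixOf gs i)) ∧
          ∀ k : ℕ, ContinuousOn (fun x : ℝ => betaOfRecord₁₃ F 2 (theta13OfThm1CCMWZB F 2 j (1 / 2) a₀ ε₀ ε₂₉ B₃ B₃' a₀ a₁ Efl logz) k (clampPrefix (betaOfRecord₁₃ F 2 (theta13OfThm1CCMWZB F 2 j (1 / 2) a₀ ε₀ ε₂₉ B₃ B₃' a₀ a₁ Efl logz)) γ₁ k x))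
            {x : ℝ | 0 < x ∧ x ≤ γ₁ ∧ ∀ i, i ≤ k → 1 / γ₁ ^ 2 ≤ Y (betaOfRecord₁₃ F 2 (theta13OfThm1CCMWZB F 2 j (1 / 2) a₀ ε₀ ε₂₉ B₃ B₃' a₀ a₁ Efl logz)) γ₁ i x})
    (hK1 : StabilityBRunRowsAtRecordR13SepCoPHV) (hK3 : SpineGivenEndpointR13SepCoPHV) :
    Summit.QuantumFields.YangMills.Theses.BalabanLadder.UV :=
  closes (record13SepCoPHInhabited_of_cofinalBetaSocket hβc) hK1 endpointGivenRunRowsR13SepCoPHV_holds hK3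

end Summit.QuantumFields.YangMills.BalabanUVNodes.N24K0K1JunctionOfCofinalBetaSocket

end
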